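import Mathlib
import HarnessLib

/-!
# The Hermitian trace form of a CM field is positive definite; trace-constant slices are
norm-difference-free

Topic `Literature/NumberTheory/NumberFields`.  Let `K` be a CM field with complex conjugation `c`
(Mathlib: `NumberField.IsCMField.complexConj`).  For every complex embedding `τ` one has
`τ(c z) = conj (τ z)`, so `Tr_{K/ℚ}(z · c z) = Σ_τ |τ z|² > 0` unless `z = 0`: complex conjugation is a
POSITIVE involution and the Hermitian trace form `(z, w) ↦ Tr(z · c w)` is positive definite (the
classical starting point of the theory of complex multiplication, e.g. Milne's notes, Ch. I §1; for
`c = id` on a totally real field this is the positivity of the trace form, `trace_sq_pos` of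
`…TraceFormTotallyReal`).  Consequences:
`Tr ∘ c = Tr`, and a relative norm `z · c z` of trace zero vanishes — so two elements of equal trace never
differ (after symmetrisation) by twice a non-zero relative norm: the "norm-difference-free" input of the
CM-Hermitian lift of tangency sets (the unital analogue of Pohoata's trace-zero parabola lift,
arXiv:2607.20422, Prop. 3.2).

* `trace_mul_complexConj_pos` — `z ≠ 0 ⇒ 0 < Tr_{K/ℚ}(z · c z)`;
* `eq_zero_of_trace_mul_complexConj_eq_zero` — `Tr(z · c z) = 0 ⇒ z = 0`;
* `trace_complexConj` — `Tr(c z) = Tr z`;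
* `eq_of_trace_eq_of_sub_eq_two_mul_norm` — if `Tr u = Tr u'` and
  `(u' + c u') − (u + c u) = 2 (x − x') · c (x − x')` then `x = x'`.

Mathlib ingredients: `trace_eq_sum_embeddings`, `IsCMField.complexEmbedding_complexConj`,
`Complex.mul_conj`, `Complex.normSq_pos`.  No definitions.

## References
* J. S. Milne, *Complex Multiplication*, course notes (2006), Chapter I, §1 (CM-algebras: complex
  conjugation `ι` of a CM field is a positive involution, `Tr_{E/ℚ}(x · ι x) = Σ_ρ |ρ x|² > 0`).
  [MilneCM2006]
* C. Pohoata, arXiv:2607.20422 (2026), Observation 3.1 / Prop. 3.2 (the totally real case).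
  [Pohoata2026SharpExponentMinimalDistance]
-/

namespace Literature.NumberTheory.NumberFields

open NumberField
open scoped ComplexConjugate

variable {K : Type*} [Field K] [NumberField K]

/-- **Positivity of the Hermitian trace form (CM fields).**  If `K` is a CM field with complex
conjugation `c` and `z ≠ 0` then `0 < Tr_{K/ℚ}(z · c z)`: under the embeddings into `ℂ` the trace
becomes `Σ_τ τ(z) · conj (τ z) = Σ_τ |τ z|²`, a sum of squared absolute values of non-zero complex
numbers. [cite: MilneCM2006, Ch. I §1] -/
theorem trace_mul_complexConj_pos [IsCMField K] {z : K} (hz : z ≠ 0) :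
    0 < Algebra.trace ℚ K (z * IsCMField.complexConj K z) := by
  classical
  set t : ℚ := Algebra.trace ℚ K (z * IsCMField.complexConj K z) with ht
  -- trace as a sum over the complex embeddings, each term `τ z · conj (τ z) = |τ z|²`
  have key : ((t : ℚ) : ℂ) = ((∑ τ : K →ₐ[ℚ] ℂ, Complex.normSq (τ z) : ℝ) : ℂ) := by
    have h := trace_eq_sum_embeddings ℂ (K := ℚ) (L := K) (x := z * IsCMField.complexConj K z)
    rw [eq_ratCast] at h
    rw [ht, h]
    push_cast
    refine Finset.sum_congr rfl fun τ _ => ?_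
    have hc : τ (IsCMField.complexConj K z) = conj (τ z) :=
      IsCMField.complexEmbedding_complexConj K (τ : K →+* ℂ) z
    rw [map_mul, hc, Complex.mul_conj]
  -- the real sum is positive: every embedding is injective and there is at least one embedding
  have hpos : 0 < ∑ τ : K →ₐ[ℚ] ℂ, Complex.normSq (τ z) := by
    have hnonempty : (Finset.univ : Finset (K →ₐ[ℚ] ℂ)).Nonempty := by
      have hcard : Fintype.card (K →ₐ[ℚ] ℂ) = Module.finrank ℚ K := AlgHom.card ℚ K ℂ
      have hpos : 0 < Fintype.card (K →ₐ[ℚ] ℂ) := by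
        rw [hcard]; exact Module.finrank_pos
      obtain ⟨τ⟩ := Fintype.card_pos_iff.mp hpos
      exact ⟨τ, Finset.mem_univ _⟩
    apply Finset.sum_pos _ hnonempty
    intro τ _
    have hne : τ z ≠ 0 := fun h0 =>
      hz ((map_eq_zero_iff τ (RingHom.injective (τ : K →+* ℂ))).mp h0)
    exact Complex.normSq_pos.mpr hne
  -- transfer back to `ℚ`
  have hq : ((t : ℚ) : ℝ) = ∑ τ : K →ₐ[ℚ] ℂ, Complex.normSq (τ z) := by
    have h1 : (((t : ℚ) : ℝ) : ℂ) = ((t : ℚ) : ℂ) := by norm_cast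
    exact_mod_cast h1.trans key
  exact_mod_cast (hq ▸ hpos : (0 : ℝ) < ((t : ℚ) : ℝ))

/-- In a CM field, `Tr(z · c z) = 0` forces `z = 0` (no non-zero relative norm `z · c z` has trace
zero). [cite: MilneCM2006, Ch. I §1] -/
theorem eq_zero_of_trace_mul_complexConj_eq_zero [IsCMField K] {z : K}
    (h : Algebra.trace ℚ K (z * IsCMField.complexConj K z) = 0) : z = 0 := by
  by_contra hz
  exact (trace_mul_complexConj_pos hz).ne' h

/-- **The trace is invariant under complex conjugation**: `Tr_{K/ℚ}(c z) = Tr_{K/ℚ}(z)` (under the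
embeddings both sides are `Σ_τ τ z` up to complex conjugation, and the trace is rational).
[cite: MilneCM2006, Ch. I §1] -/
theorem trace_complexConj [IsCMField K] (z : K) :
    Algebra.trace ℚ K (IsCMField.complexConj K z) = Algebra.trace ℚ K z := by
  classical
  have h1 := trace_eq_sum_embeddings ℂ (K := ℚ) (L := K) (x := IsCMField.complexConj K z)
  have h2 := trace_eq_sum_embeddings ℂ (K := ℚ) (L := K) (x := z)
  rw [eq_ratCast] at h1 h2
  have key : ((Algebra.trace ℚ K (IsCMField.complexConj K z) : ℚ) : ℂ) =
      conj ((Algebra.trace ℚ K z : ℚ) : ℂ) := by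
    rw [h1, h2, map_sum]
    refine Finset.sum_congr rfl fun τ _ => ?_
    exact IsCMField.complexEmbedding_complexConj K (τ : K →+* ℂ) z
  rw [map_ratCast] at key
  exact_mod_cast key

/-- **Trace-constant slices are norm-difference-free** (the CM analogue of Pohoata's Prop. 3.2): in a
CM field with complex conjugation `c`, if `Tr u = Tr u'` and
`(u' + c u') − (u + c u) = 2 · (x − x') · c (x − x')`, then `x = x'` — take traces: the left side has
trace `2 Tr u' − 2 Tr u = 0`, so the relative norm `(x − x') · c (x − x')` has trace zero.  This is the
input that makes the Hermitian-unital lift over the integers of a CM field collision-free.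
[cite: MilneCM2006, Ch. I §1; Pohoata2026SharpExponentMinimalDistance, Prop. 3.2] -/
theorem eq_of_trace_eq_of_sub_eq_two_mul_norm [IsCMField K] {u u' x x' : K}
    (htr : Algebra.trace ℚ K u = Algebra.trace ℚ K u')
    (h : (u' + IsCMField.complexConj K u') - (u + IsCMField.complexConj K u) =
      2 * ((x - x') * IsCMField.complexConj K (x - x'))) : x = x' := by
  set w : K := (x - x') * IsCMField.complexConj K (x - x') with hw
  have h2 : (2 : K) * w = w + w := two_mul w
  have htrace := congrArg (Algebra.trace ℚ K) h
  rw [h2, map_add, map_sub, map_add, map_add, trace_complexConj, trace_complexConj, htr, sub_self]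
    at htrace
  have hw0 : Algebra.trace ℚ K w = 0 := by linarith
  have := eq_zero_of_trace_mul_complexConj_eq_zero hw0
  exact sub_eq_zero.mp this

end Literature.NumberTheory.NumberFields
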